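import Summits.HubbardSuperconductivity.HubbardSuperconductivity.Theorems.DeformationLadderLowEnergyRigidityTelescopeReduction
import Summits.HubbardSuperconductivity.HubbardSuperconductivity.Theorems.DeformationLadderLowEnergyRigidityTelescopeRigidityVectors
import Summits.HubbardSuperconductivity.HubbardSuperconductivity.Theorems.DeformationLadderLowEnergyRigidityTelescopeRigidityPhases
import Summits.HubbardSuperconductivity.HubbardSuperconductivity.Theses.TwistGap
import Literature.MathematicalPhysics.QuantumLattice.DWaveSourceProofs
import Literature.MathematicalPhysics.QuantumLattice.BondPairModes

/-!
# Telescope rigidity, part 3: the scale-wise Josephson inequality implies pair-momentum rigidity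

Route `DeformationLadder`, crux `LowEnergyRigidity` (item stmt-HubbardSuperconductivity-1892), line
`Sketch` (poincare-telescope). Support file (`--supports stmt-HubbardSuperconductivity-1892`).

**Theorem** (`pairMomentumRigidity_of_josephsonInequalityAt`). At a point `(U, δ)`, the telescope's
open input 1 — the scale-wise Josephson family `JosephsonInequalityAt U δ J C ℓ₁` with some rate
`J > 0` (`TelescopeDefs`) — implies the body of TwistGap's rigidity crux
`TwistGap.TgPairMomentumRigidity` (item stmt-HubbardSuperconductivity-1509) AT THAT POINT: for every
window size `K` and slack `σ > 0` there are `γ > 0`, `L₀` with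
`γ · (Σ_{0 ≠ k₀ ∈ W_K} P_{k₀}(φ) − σ) ≤ Re⟨φ, H_L φ⟩ − E₀(L)` for all even `L ≥ L₀` and all unit sector
vectors `φ` (`P_{k₀}(φ) = L⁻⁴ Re⟨φ, Δ_d(k₀)ᴴ Δ_d(k₀) φ⟩`, `Δ_d(k₀) = Σ_x e^{−2πi k₀·x/L} P_x`).
Corollary (`tgPairMomentumRigidity_of_josephson`): the Josephson family at EVERY `(U, δ)` gives
`TwistGap.TgPairMomentumRigidity` by name (a CONDITIONAL result; the hypothesis is conjecture-grade).

**Proof.** Fix a dyadic cell count `k = 4·2^m > K`. For a window momentum `k₀ ≠ 0` write the phase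
`e_x = c_b + (e_x − c_b)` on the cell `b ∋ x`, with the cell phase `c_b = conj χ_κ̄(b)` of the cell
torus `(ℤ/kℤ)²` (`κ̄ = κ mod k ≠ 0`, `κ` the signed representatives of `k₀`): `Σ_b c_b = 0` and
`|e_x − c_b| ≤ 4πK/k` (part 2). The coarse-graining inequality (part 1) gives
`P_{k₀} ≤ 2(ρ_k − P_0) + 2(4πK/k)² p₀²` with the cell coherence density `ρ_k = (k²/L⁴) Re⟨𝒞_k⟩` and
`p₀ = 2 Σ_e |d(e)/√2| ≥ ‖P_x‖`; the landed telescope (`stub_topPoincare`, `stub_chain`) and the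
Josephson family at the scales `4, 8, …, k` give `ρ_k − P_0 ≤ (Re⟨H_L⟩ − E₀)/(24J) + C(k+2)/L`.
Summing over the at most `(2K+1)²` window momenta and choosing `k`, then `L₀`, large makes the
`L`-independent error `< σ` and leaves `γ = 12 J/(2K+1)²`.

Consequence for the node (planning evidence, not movement on its truth): with the landed
`Telescope.lowEnergyRigidity_of_josephson_of_floor` (inputs 1 ∧ 2 ⟹ crux) and
`TwistGap.tgLowEnergyCondensation_of_lowEnergyRigidity` (crux ⟹ 1510), the telescope's two inputs
at a point imply BOTH children of the D1 split `TgPairMomentumRigidity(U,δ) ∧ TgLowEnergyCondensation`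
(glue `TwistGap.lowEnergyRigidity_of_tgCruxes`): D1 at the point is the weaker pair of obligations.
Elementary finite-dimensional estimates; no definitions are introduced. [folklore]
-/

noncomputable section

namespace Summit.HubbardSuperconductivity.HubbardSuperconductivity.Theorems.LowEnergyRigidity.Telescope

set_option linter.dupNamespace false -- summit = problem name (single-conjunct summit), D-0017

open Matrix Complex Finset Literature.MathematicalPhysics.QuantumLattice Literature.Probability.LatticeModels
open scoped ComplexConjugate ComplexOrder Matrix.Norms.L2Operator
open Summit.HubbardSuperconductivity.HubbardSuperconductivity.Theses.DeformationLadder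
open Summit.HubbardSuperconductivity.HubbardSuperconductivity.Theorems (minEnergyOn_le_re_rayleigh)

/-! ### Expectations as Euclidean norms -/

/-- `Re ⟨φ, Aᴴ A φ⟩ = ‖A φ‖₂²`. [folklore] -/
theorem rig_re_expect_gram {ι : Type*} [Fintype ι] (A : Matrix (Finset ι) (Finset ι) ℂ) (φ : Fock ι) :
    (expect (Aᴴ * A) φ).re = eucNorm (A *ᵥ φ) ^ 2 := by
  rw [expect_conjTranspose_mul_self, eucNorm_sq]

/-- `(Σ_x e_x • P_x) φ = Σ_x e_x • (P_x φ)`. [folklore] -/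
theorem rig_sum_smul_mulVec {ι X : Type*} [Fintype ι] [Fintype X] (e : X → ℂ)
    (P : X → Matrix (Finset ι) (Finset ι) ℂ) (φ : Fock ι) :
    (∑ x, e x • P x) *ᵥ φ = ∑ x, e x • (P x *ᵥ φ) := by
  rw [Matrix.sum_mulVec]
  exact Finset.sum_congr rfl fun x _ => smul_mulVec _ _ _

/-- The cell coherence expectation is the sum of the squared norms of the cell pair fields:
`Re⟨φ, 𝒞_k φ⟩ = Σ_b ‖Δ_b φ‖₂²`, `Δ_b φ = Σ_{cellOf x = b} P_x φ`. [folklore] -/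
theorem rig_re_expect_cellCoherence (L : ℕ) [NeZero L] (k : ℕ) [NeZero k] (φ : Fock (Orb (FermionTorus 2 L))) :
    (expect (cellCoherence L k) φ).re =
      ∑ b : TorusSite 2 k, eucNorm (∑ x ∈ Finset.univ.filter (fun x => cellOf L k x = b),
        localPair dWaveFormFactor L x *ᵥ φ) ^ 2 := by
  unfold cellCoherence
  rw [re_expect_sum]
  refine Finset.sum_congr rfl fun b _ => ?_
  rw [rig_re_expect_gram]
  unfold cellPair
  rw [Matrix.sum_mulVec]

/-- A priori bound on the local pairs: `Σ_x ‖P_x φ‖₂² ≤ L² p₀²` for a unit vector `φ`, with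
`p₀ = 2 Σ_e |d(e)/√2|` (`norm_localPair_le`). [folklore] -/
theorem rig_sum_eucNorm_localPair_sq_le (L : ℕ) [NeZero L] {φ : Fock (Orb (FermionTorus 2 L))}
    (hφ : star φ ⬝ᵥ φ = 1) :
    ∑ x : TorusSite 2 L, eucNorm (localPair dWaveFormFactor L x *ᵥ φ) ^ 2 ≤
      (L : ℝ) ^ 2 * (2 * ∑ e ∈ insert (0 : Site 2) unitSteps, |dWaveFormFactor e / Real.sqrt 2|) ^ 2 := by
  set p₀ := 2 * ∑ e ∈ insert (0 : Site 2) unitSteps, |dWaveFormFactor e / Real.sqrt 2| with hp₀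
  have hx : ∀ x : TorusSite 2 L, eucNorm (localPair dWaveFormFactor L x *ᵥ φ) ^ 2 ≤ p₀ ^ 2 := by
    intro x
    have h1 : eucNorm (localPair dWaveFormFactor L x *ᵥ φ) ≤ p₀ := by
      refine (eucNorm_mulVec_le _ _).trans ?_
      rw [eucNorm_eq_one hφ, mul_one]
      exact norm_localPair_le dWaveFormFactor L x
    exact pow_le_pow_left₀ (eucNorm_nonneg _) h1 2
  calc ∑ x : TorusSite 2 L, eucNorm (localPair dWaveFormFactor L x *ᵥ φ) ^ 2
      ≤ ∑ _x : TorusSite 2 L, p₀ ^ 2 := Finset.sum_le_sum fun x _ => hx x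
    _ = (L : ℝ) ^ 2 * p₀ ^ 2 := by
        rw [Finset.sum_const, Finset.card_univ, BondMode.card_torusSite_two, nsmul_eq_mul]
        push_cast
        ring

/-! ### The pair mode at a window momentum against the cell coherence -/

/-- **Coarse-graining of a window pair mode.** For a cell count `k > K` and a nonzero window momentum
`k₀` (`min((k₀ i).val, L − (k₀ i).val) ≤ K`), every vector `φ` satisfies
`‖Δ_d(k₀) φ‖₂² ≤ 2 k² Re⟨φ, 𝒞_k φ⟩ − 2 Re⟨φ, Δ_dᴴ Δ_d φ⟩ + 2 (4πK/k)² L² Σ_x ‖P_x φ‖₂²`. [folklore] -/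
theorem rig_pairMode_sq_le (L : ℕ) [NeZero L] (k : ℕ) [NeZero k] (K : ℕ) (hKk : K < k)
    (k₀ : TorusSite 2 L) (hk₀ : k₀ ≠ 0) (hwin : ∀ i : Fin 2, min (k₀ i).val (L - (k₀ i).val) ≤ K)
    (φ : Fock (Orb (FermionTorus 2 L))) :
    eucNorm ((∑ x : TorusSite 2 L, Complex.exp (-(2 * (Real.pi : ℂ) * Complex.I / (L : ℂ)) *
        ((∑ i : Fin 2, (k₀ i).val * (x i).val : ℕ) : ℂ)) • localPair dWaveFormFactor L x) *ᵥ φ) ^ 2 ≤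
      2 * (k : ℝ) ^ 2 * (expect (cellCoherence L k) φ).re -
        2 * (expect ((pairField dWaveFormFactor L)ᴴ * pairField dWaveFormFactor L) φ).re +
        2 * (4 * Real.pi * K / k) ^ 2 * (L : ℝ) ^ 2 *
          ∑ x : TorusSite 2 L, eucNorm (localPair dWaveFormFactor L x *ᵥ φ) ^ 2 := by
  classical
  -- signed representatives of the window momentum
  have hrep : ∀ i : Fin 2, ∃ κt : ℤ × ℤ, |κt.1| ≤ K ∧ (((k₀ i).val : ℤ) = κt.1 + (L : ℤ) * κt.2) ∧
      (k₀ i ≠ 0 → κt.1 ≠ 0) := by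
    intro i
    obtain ⟨κ, t, h1, h2, h3⟩ := rig_window_rep (K := K) (k₀ i) (hwin i)
    exact ⟨(κ, t), h1, h2, h3⟩
  choose κt hκt using hrep
  set κ : Fin 2 → ℤ := fun i => (κt i).1 with hκ
  set t : Fin 2 → ℤ := fun i => (κt i).2 with ht
  have hκK : ∀ i, |κ i| ≤ K := fun i => (hκt i).1
  have hrep' : ∀ i, (((k₀ i).val : ℕ) : ℤ) = κ i + (L : ℤ) * t i := fun i => (hκt i).2.1
  have hκ0 : ∃ i, κ i ≠ 0 := by
    by_contra h
    push Not at h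
    apply hk₀
    funext i
    by_contra hi
    exact (hκt i).2.2 hi (h i)
  set κb : TorusSite 2 k := fun i => ((κ i : ℤ) : ZMod k) with hκb
  have hκb0 : κb ≠ 0 := rig_cellMomentum_ne_zero hKk κ hκK hκ0
  -- the abstract inequality
  set e : TorusSite 2 L → ℂ := fun x => Complex.exp (-(2 * (Real.pi : ℂ) * Complex.I / (L : ℂ)) *
      ((∑ i : Fin 2, (k₀ i).val * (x i).val : ℕ) : ℂ)) with he
  set c : TorusSite 2 k → ℂ := fun b => conj (torusChar κb b) with hc
  set u : TorusSite 2 L → Fock (Orb (FermionTorus 2 L)) := fun x => localPair dWaveFormFactor L x *ᵥ φ with hu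
  have hc1 : ∀ b, ‖c b‖ ≤ 1 := fun b => by
    rw [hc]; simp only [RCLike.norm_conj, norm_torusChar]; exact le_rfl
  have hc0 : ∑ b, c b = 0 := rig_sum_cellPhase_eq_zero k hκb0
  have hec : ∀ x, ‖e x - c (cellOf L k x)‖ ≤ 4 * Real.pi * K / k := fun x =>
    rig_norm_phase_sub_cellPhase_le L k K k₀ κ t hκK hrep' x
  have hmain := rig_eucNorm_sq_sum_smul_le u (cellOf L k) e c hc1 hc0 hec
  -- identify the terms
  rw [rig_sum_smul_mulVec]
  rw [BondMode.card_torusSite_two, BondMode.card_torusSite_two, ← rig_re_expect_cellCoherence L k φ] at hmain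
  have hV : ∑ x, u x = pairField dWaveFormFactor L *ᵥ φ := by
    rw [hu]; unfold pairField; rw [Matrix.sum_mulVec]
  rw [hV, ← rig_re_expect_gram] at hmain
  have hk : (0 : ℝ) < k := Nat.cast_pos.mpr (Nat.pos_of_ne_zero (NeZero.ne k))
  have hk2 : ((k ^ 2 : ℕ) : ℝ) = (k : ℝ) ^ 2 := by push_cast; ring
  rw [hk2] at hmain
  have hL2 : ((L ^ 2 : ℕ) : ℝ) = (L : ℝ) ^ 2 := by push_cast; ring
  rw [hL2] at hmain
  refine hmain.trans (le_of_eq ?_)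
  field_simp
  ring

/-! ### The density budget of the telescope under the Josephson family -/

/-- The arithmetic of the budget: from the top Poincaré step, the Josephson inequality at `k = 4` and
the chain `ρ_k ≤ ρ_4 + E/(96J) + Ck/L`, the excess cell coherence obeys
`ρ_k − P_0 ≤ E/(24J) + C(k+2)/L`. [folklore] -/
theorem rig_budget_arith {c1 c4 d4 cK E J C L kr : ℝ} (hJ : 0 < J) (hL : 0 < L)
    (htop : 16 * c4 - 8 * d4 ≤ c1)
    (hJ4 : J * (4 / L) ^ 4 * d4 - C * J * 4 ^ 3 / L ≤ E)
    (hchain : kr ^ 2 / L ^ 4 * cK ≤ 4 ^ 2 / L ^ 4 * c4 + E / (96 * J) + C * kr / L) :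
    kr ^ 2 / L ^ 4 * cK - c1 / L ^ 4 ≤ E / (24 * J) + C * (kr + 2) / L := by
  have hL4 : 0 < L ^ 4 := by positivity
  -- `8 d4 / L⁴ ≤ E/(32J) + 2C/L`
  have hd4 : 8 * d4 / L ^ 4 ≤ E / (32 * J) + 2 * C / L := by
    have h1 : J * (4 / L) ^ 4 * d4 ≤ E + C * J * 4 ^ 3 / L := by linarith
    have h2 : (4 / L) ^ 4 * d4 ≤ (E + C * J * 4 ^ 3 / L) / J := by
      rw [le_div_iff₀ hJ]; nlinarith
    have h3 : 8 * d4 / L ^ 4 = (1 / 32) * ((4 / L) ^ 4 * d4) := by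
      field_simp; ring
    rw [h3]
    have h4 : (1 / 32 : ℝ) * ((4 / L) ^ 4 * d4) ≤ (1 / 32) * ((E + C * J * 4 ^ 3 / L) / J) :=
      mul_le_mul_of_nonneg_left h2 (by norm_num)
    refine h4.trans (le_of_eq ?_)
    field_simp
    ring
  have htop' : 4 ^ 2 / L ^ 4 * c4 ≤ c1 / L ^ 4 + 8 * d4 / L ^ 4 := by
    rw [div_mul_eq_mul_div, ← add_div, div_le_div_iff_of_pos_right hL4]
    linarith
  have hEJ : E / (32 * J) + E / (96 * J) = E / (24 * J) := by
    field_simp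
    ring
  have hCk : C * (kr + 2) / L = C * kr / L + 2 * C / L := by
    rw [show C * (kr + 2) = C * kr + 2 * C by ring, add_div]
  linarith

/-! ### The main theorem -/

/-- **The Josephson family implies pair-momentum rigidity at the point.** For `0 < J` and
`JosephsonInequalityAt U δ J C ℓ₁` (the telescope's open input 1 at `(U, δ)`), the body of
`TwistGap.TgPairMomentumRigidity` holds at `(U, δ)`: for every window size `K` and slack `σ > 0`
there are `γ > 0` and `L₀` such that for all even `L ≥ L₀` and all unit vectors `φ` of the sector
`szSector (2⌊(1-δ)L²/2⌋) 0`,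
`γ · (Σ_{0 ≠ k₀ ∈ W_K} L⁻⁴ Re⟨φ, Δ_d(k₀)ᴴ Δ_d(k₀) φ⟩ − σ) ≤ Re⟨φ, H_L φ⟩ − minEnergyOn H_L (sector)`.
A CONDITIONAL result (the hypothesis is conjecture-grade); nothing is claimed about it here. [folklore] -/
theorem pairMomentumRigidity_of_josephsonInequalityAt :
    ∀ (U δ J C : ℝ) (ℓ₁ : ℕ), 0 < J → JosephsonInequalityAt U δ J C ℓ₁ →
    ∀ (K : ℕ) (σ : ℝ), 0 < σ → ∃ γ : ℝ, 0 < γ ∧ ∃ L₀ : ℕ, ∀ (L : ℕ) [NeZero L], L₀ ≤ L → Even L →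
      ∀ φ : Fock (Orb (FermionTorus 2 L)),
        φ ∈ (szSector (Λ := FermionTorus 2 L) (2 * ⌊(1 - δ) * (L : ℝ) ^ 2 / 2⌋₊) 0) → star φ ⬝ᵥ φ = 1 →
        γ * ((∑ k ∈ (Finset.univ.filter (fun k : TorusSite 2 L => k ≠ 0 ∧ ∀ i : Fin 2, min (k i).val (L - (k i).val) ≤ K)),
            (expect (Matrix.conjTranspose (∑ x : TorusSite 2 L, Complex.exp (-(2 * (Real.pi : ℂ) * Complex.I / (L : ℂ)) *
                ((∑ i : Fin 2, (k i).val * (x i).val : ℕ) : ℂ)) • localPair dWaveFormFactor L x) *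
              (∑ x : TorusSite 2 L, Complex.exp (-(2 * (Real.pi : ℂ) * Complex.I / (L : ℂ)) *
                ((∑ i : Fin 2, (k i).val * (x i).val : ℕ) : ℂ)) • localPair dWaveFormFactor L x)) φ).re / (L : ℝ) ^ 4) - σ) ≤
          (expect (hubbardTorus 2 L 1 U) φ).re -
            (hubbardTorus 2 L 1 U).minEnergyOn (szSector (Λ := FermionTorus 2 L) (2 * ⌊(1 - δ) * (L : ℝ) ^ 2 / 2⌋₊) 0) := by
  classical
  intro U δ J C ℓ₁ hJ hJos K σ hσ
  -- nonnegative slack and the Josephson threshold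
  have hCp0 : (0 : ℝ) ≤ max C 0 := le_max_right _ _
  obtain ⟨LJ, hJosL⟩ := josephsonInequalityAt_mono_slack hJ (le_max_left C 0) hJos
  -- constants
  set p₀ : ℝ := 2 * ∑ e ∈ insert (0 : Site 2) unitSteps, |dWaveFormFactor e / Real.sqrt 2| with hp₀
  have hp₀0 : 0 ≤ p₀ := by
    rw [hp₀]; exact mul_nonneg zero_le_two (Finset.sum_nonneg fun _ _ => abs_nonneg _)
  set M : ℝ := (((2 * K + 1) ^ 2 : ℕ) : ℝ) with hM
  have hM1 : (1 : ℝ) ≤ M := by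
    rw [hM]; exact_mod_cast Nat.one_le_pow _ _ (Nat.succ_pos _)
  have hM0 : 0 < M := lt_of_lt_of_le one_pos hM1
  -- the dyadic cell count `k = 4·2^m`, `k > K`, `2 M (4πK p₀)² / k ≤ σ/2`
  set A : ℝ := max (K : ℝ) (4 * M * (4 * Real.pi * K * p₀) ^ 2 / σ) with hA
  obtain ⟨m, hm⟩ := pow_unbounded_of_one_lt A (by norm_num : (1 : ℝ) < 2)
  set k : ℕ := 4 * 2 ^ m with hk
  haveI : NeZero k := ⟨by rw [hk]; positivity⟩
  have hkr : (k : ℝ) = 4 * (2 : ℝ) ^ m := by rw [hk]; push_cast; ring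
  have hk1 : (1 : ℝ) ≤ k := by exact_mod_cast Nat.pos_of_ne_zero (NeZero.ne k)
  have hkpos : (0 : ℝ) < k := lt_of_lt_of_le one_pos hk1
  have hAk : A < k := by
    rw [hkr]
    have : (2 : ℝ) ^ m ≤ 4 * 2 ^ m := by nlinarith [pow_pos (two_pos : (0 : ℝ) < 2) m]
    exact lt_of_lt_of_le hm this
  have hKk : K < k := by
    have : (K : ℝ) < k := lt_of_le_of_lt (le_max_left _ _) hAk
    exact_mod_cast this
  have herr : 2 * M * (4 * Real.pi * K / k) ^ 2 * p₀ ^ 2 ≤ σ / 2 := by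
    have h1 : 4 * M * (4 * Real.pi * K * p₀) ^ 2 / σ < k := lt_of_le_of_lt (le_max_right _ _) hAk
    rw [div_lt_iff₀ hσ] at h1
    have h2 : 2 * M * (4 * Real.pi * K / k) ^ 2 * p₀ ^ 2 = (2 * M * (4 * Real.pi * K * p₀) ^ 2) / k ^ 2 := by
      field_simp
    rw [h2, div_le_iff₀ (by positivity)]
    have h3 : (k : ℝ) ≤ (k : ℝ) ^ 2 := by nlinarith
    nlinarith [hM0, sq_nonneg (4 * Real.pi * K * p₀)]
  -- the side threshold: Josephson, admissibility of all scales up to `k`, and `2 M C (k+2)/L ≤ σ/2`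
  set L₀ : ℕ := max (max LJ (k * ℓ₁)) (⌈4 * M * max C 0 * (k + 2) / σ⌉₊ + 1) with hL₀
  refine ⟨12 * J / M, by positivity, L₀, ?_⟩
  intro L _ hL hev φ hφK hφ1
  have hLJ : LJ ≤ L := le_trans (le_trans (le_max_left _ _) (le_max_left _ _)) hL
  have hkℓ₁ : k * ℓ₁ ≤ L := le_trans (le_trans (le_max_right _ _) (le_max_left _ _)) hL
  have hLC : ⌈4 * M * max C 0 * (k + 2) / σ⌉₊ + 1 ≤ L := le_trans (le_max_right _ _) hL
  have hLpos : (0 : ℝ) < L := by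
    have : 1 ≤ L := le_trans (by omega) hLC
    exact_mod_cast this
  have hslack : 2 * M * (max C 0 * ((k : ℝ) + 2) / L) ≤ σ / 2 := by
    have h1 : 4 * M * max C 0 * (k + 2) / σ ≤ (L : ℝ) := by
      have := Nat.le_ceil (4 * M * max C 0 * (k + 2) / σ)
      have h3 : ((⌈4 * M * max C 0 * ((k : ℝ) + 2) / σ⌉₊ : ℕ) : ℝ) + 1 ≤ (L : ℝ) := by exact_mod_cast hLC
      linarith
    rw [div_le_iff₀ hσ] at h1
    rw [show 2 * M * (max C 0 * ((k : ℝ) + 2) / L) = (2 * M * max C 0 * (k + 2)) / L by ring,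
      div_le_iff₀ hLpos]
    linarith
  -- abbreviations
  set H := hubbardTorus 2 L 1 U with hH
  set Sec := szSector (Λ := FermionTorus 2 L) (2 * ⌊(1 - δ) * (L : ℝ) ^ 2 / 2⌋₊) 0 with hSec
  set E : ℝ := (expect H φ).re - H.minEnergyOn Sec with hE
  have hEeq : (star φ ⬝ᵥ H *ᵥ φ).re - H.minEnergyOn Sec = E := rfl
  -- the excess energy is nonnegative (variational principle)
  have hE0 : 0 ≤ E := sub_nonneg.mpr (minEnergyOn_le_re_rayleigh _ _ hφK hφ1)
  -- the scale-wise Josephson bounds at this `L`, this `φ`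
  have hJk : ∀ (k' : ℕ) [NeZero k'], 4 ≤ k' → k' * ℓ₁ ≤ L →
      J * ((k' : ℝ) / (L : ℝ)) ^ 4 * (expect (cellDirichlet L k') φ).re - max C 0 * J * (k' : ℝ) ^ 3 / (L : ℝ) ≤ E :=
    fun k' _ hk' hk'l => hJosL L hLJ hev k' hk' hk'l φ hφK hφ1
  clear_value E
  -- the chain up to `k = 4·2^m`, the top step and Josephson at `4`
  have hmℓ₁ : 4 * 2 ^ m * ℓ₁ ≤ L := hkℓ₁
  have hchain := stub_chain L J (max C 0) E ℓ₁ φ hJ hCp0 hE0 hJk m hmℓ₁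
  have htop := stub_topPoincare L φ
  have h4ℓ₁ : 4 * ℓ₁ ≤ L := le_trans (Nat.mul_le_mul_right _ (by
    rw [hk]; exact Nat.le_mul_of_pos_right _ (Nat.two_pow_pos _))) hkℓ₁
  have hJ4 := hJk 4 (by norm_num) h4ℓ₁
  simp only [Nat.cast_ofNat] at hJ4
  have hkcast : ((4 * 2 ^ m : ℕ) : ℝ) = (k : ℝ) := by rw [hk]
  rw [hkcast] at hchain
  rw [cellCoherence_congr L (show 4 * 2 ^ m = k from rfl)] at hchain
  have hbudget := rig_budget_arith (cK := (expect (cellCoherence L k) φ).re) hJ hLpos htop hJ4 hchain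
  -- per-momentum bound
  have hP : ∀ k₀ ∈ Finset.univ.filter (fun k : TorusSite 2 L => k ≠ 0 ∧ ∀ i : Fin 2, min (k i).val (L - (k i).val) ≤ K),
      (expect (Matrix.conjTranspose (∑ x : TorusSite 2 L, Complex.exp (-(2 * (Real.pi : ℂ) * Complex.I / (L : ℂ)) *
          ((∑ i : Fin 2, (k₀ i).val * (x i).val : ℕ) : ℂ)) • localPair dWaveFormFactor L x) *
        (∑ x : TorusSite 2 L, Complex.exp (-(2 * (Real.pi : ℂ) * Complex.I / (L : ℂ)) *
          ((∑ i : Fin 2, (k₀ i).val * (x i).val : ℕ) : ℂ)) • localPair dWaveFormFactor L x)) φ).re / (L : ℝ) ^ 4 ≤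
        E / (12 * J) + 2 * (max C 0 * ((k : ℝ) + 2) / L) + 2 * (4 * Real.pi * K / k) ^ 2 * p₀ ^ 2 := by
    intro k₀ hk₀
    rw [Finset.mem_filter] at hk₀
    rw [rig_re_expect_gram]
    have h1 := rig_pairMode_sq_le L k K hKk k₀ hk₀.2.1 hk₀.2.2 φ
    have h2 := rig_sum_eucNorm_localPair_sq_le L hφ1
    rw [← hp₀] at h2
    have hL4 : (0 : ℝ) < (L : ℝ) ^ 4 := by positivity
    rw [div_le_iff₀ hL4]
    have h3 : 2 * (4 * Real.pi * K / k) ^ 2 * (L : ℝ) ^ 2 *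
        ∑ x : TorusSite 2 L, eucNorm (localPair dWaveFormFactor L x *ᵥ φ) ^ 2 ≤
        2 * (4 * Real.pi * K / k) ^ 2 * (L : ℝ) ^ 2 * ((L : ℝ) ^ 2 * p₀ ^ 2) :=
      mul_le_mul_of_nonneg_left h2 (by positivity)
    -- `2 k² Re⟨𝒞_k⟩ − 2 Re⟨Δ†Δ⟩ ≤ 2 L⁴ (E/(24J) + C(k+2)/L)`
    have h4 : 2 * (k : ℝ) ^ 2 * (expect (cellCoherence L k) φ).re -
        2 * (expect ((pairField dWaveFormFactor L)ᴴ * pairField dWaveFormFactor L) φ).re ≤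
        2 * (L : ℝ) ^ 4 * (E / (24 * J) + max C 0 * ((k : ℝ) + 2) / L) := by
      have := hbudget
      rw [div_mul_eq_mul_div, ← sub_div, div_le_iff₀ hL4] at this
      linarith
    have h5 := h1.trans (by linarith [h3, h4] : _ ≤ 2 * (L : ℝ) ^ 4 * (E / (24 * J) + max C 0 * ((k : ℝ) + 2) / L) +
        2 * (4 * Real.pi * K / k) ^ 2 * (L : ℝ) ^ 2 * ((L : ℝ) ^ 2 * p₀ ^ 2))
    refine h5.trans (le_of_eq ?_)
    field_simp
    ring
  -- sum over the window
  have hβ0 : 0 ≤ E / (12 * J) + 2 * (max C 0 * ((k : ℝ) + 2) / L) + 2 * (4 * Real.pi * K / k) ^ 2 * p₀ ^ 2 := by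
    refine add_nonneg (add_nonneg (div_nonneg hE0 (by linarith)) ?_) ?_
    · exact mul_nonneg zero_le_two (div_nonneg (mul_nonneg hCp0 (by linarith)) hLpos.le)
    · exact mul_nonneg (mul_nonneg zero_le_two (sq_nonneg _)) (sq_nonneg _)
  have hcardW : ((Finset.univ.filter (fun k : TorusSite 2 L => k ≠ 0 ∧
      ∀ i : Fin 2, min (k i).val (L - (k i).val) ≤ K)).card : ℝ) ≤ M := by
    rw [hM]; exact_mod_cast rig_card_window_le L K
  have hsum : (∑ k₀ ∈ Finset.univ.filter (fun k : TorusSite 2 L => k ≠ 0 ∧ ∀ i : Fin 2, min (k i).val (L - (k i).val) ≤ K),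
      (expect (Matrix.conjTranspose (∑ x : TorusSite 2 L, Complex.exp (-(2 * (Real.pi : ℂ) * Complex.I / (L : ℂ)) *
          ((∑ i : Fin 2, (k₀ i).val * (x i).val : ℕ) : ℂ)) • localPair dWaveFormFactor L x) *
        (∑ x : TorusSite 2 L, Complex.exp (-(2 * (Real.pi : ℂ) * Complex.I / (L : ℂ)) *
          ((∑ i : Fin 2, (k₀ i).val * (x i).val : ℕ) : ℂ)) • localPair dWaveFormFactor L x)) φ).re / (L : ℝ) ^ 4)
      ≤ M * (E / (12 * J) + 2 * (max C 0 * ((k : ℝ) + 2) / L) + 2 * (4 * Real.pi * K / k) ^ 2 * p₀ ^ 2) := by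
    refine (Finset.sum_le_sum hP).trans ?_
    rw [Finset.sum_const, nsmul_eq_mul]
    exact mul_le_mul_of_nonneg_right hcardW hβ0
  -- conclude
  have hfin : M * (E / (12 * J) + 2 * (max C 0 * ((k : ℝ) + 2) / L) + 2 * (4 * Real.pi * K / k) ^ 2 * p₀ ^ 2) - σ ≤
      M * (E / (12 * J)) := by
    have h1 : M * (2 * (max C 0 * ((k : ℝ) + 2) / L)) ≤ σ / 2 := by
      have : M * (2 * (max C 0 * ((k : ℝ) + 2) / L)) = 2 * M * (max C 0 * ((k : ℝ) + 2) / L) := by ring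
      rw [this]; exact hslack
    have h2 : M * (2 * (4 * Real.pi * K / k) ^ 2 * p₀ ^ 2) ≤ σ / 2 := by
      have : M * (2 * (4 * Real.pi * K / k) ^ 2 * p₀ ^ 2) = 2 * M * (4 * Real.pi * K / k) ^ 2 * p₀ ^ 2 := by ring
      rw [this]; exact herr
    have h3 : M * (E / (12 * J) + 2 * (max C 0 * ((k : ℝ) + 2) / L) + 2 * (4 * Real.pi * K / k) ^ 2 * p₀ ^ 2) =
        M * (E / (12 * J)) + M * (2 * (max C 0 * ((k : ℝ) + 2) / L)) + M * (2 * (4 * Real.pi * K / k) ^ 2 * p₀ ^ 2) := by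
      ring
    linarith only [h1, h2, h3]
  have hkey : (∑ k₀ ∈ Finset.univ.filter (fun k : TorusSite 2 L => k ≠ 0 ∧ ∀ i : Fin 2, min (k i).val (L - (k i).val) ≤ K),
      (expect (Matrix.conjTranspose (∑ x : TorusSite 2 L, Complex.exp (-(2 * (Real.pi : ℂ) * Complex.I / (L : ℂ)) *
          ((∑ i : Fin 2, (k₀ i).val * (x i).val : ℕ) : ℂ)) • localPair dWaveFormFactor L x) *
        (∑ x : TorusSite 2 L, Complex.exp (-(2 * (Real.pi : ℂ) * Complex.I / (L : ℂ)) *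
          ((∑ i : Fin 2, (k₀ i).val * (x i).val : ℕ) : ℂ)) • localPair dWaveFormFactor L x)) φ).re / (L : ℝ) ^ 4) - σ
      ≤ M * (E / (12 * J)) := by linarith only [hsum, hfin]
  have hγ : 0 < 12 * J / M := div_pos (by linarith) hM0
  calc 12 * J / M * (_ - σ) ≤ 12 * J / M * (M * (E / (12 * J))) := mul_le_mul_of_nonneg_left hkey hγ.le
    _ = E := by field_simp

/-- **Corollary (by name).** If the telescope's Josephson family holds at EVERY `U > 0`,
`δ ∈ (0, 1/2)` (with some `J > 0`, `C`, `ℓ₁`), then TwistGap's crux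
`Summit.HubbardSuperconductivity.HubbardSuperconductivity.Theses.TwistGap.TgPairMomentumRigidity`
(item stmt-HubbardSuperconductivity-1509) holds. CONDITIONAL: the hypothesis is conjecture-grade. [folklore] -/
theorem tgPairMomentumRigidity_of_josephson
    (h : ∀ U : ℝ, 0 < U → ∀ δ ∈ Set.Ioo (0 : ℝ) (1 / 2),
      ∃ J : ℝ, 0 < J ∧ ∃ C : ℝ, ∃ ℓ₁ : ℕ, JosephsonInequalityAt U δ J C ℓ₁) :
    Summit.HubbardSuperconductivity.HubbardSuperconductivity.Theses.TwistGap.TgPairMomentumRigidity := by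
  intro U hU δ hδ K σ hσ
  obtain ⟨J, hJ, C, ℓ₁, hJos⟩ := h U hU δ hδ
  exact pairMomentumRigidity_of_josephsonInequalityAt U δ J C ℓ₁ hJ hJos K σ hσ

end Summit.HubbardSuperconductivity.HubbardSuperconductivity.Theorems.LowEnergyRigidity.Telescope
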